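import Mathlib.Data.ZMod.Basic
import Mathlib.Data.Rat.Lemmas
import Mathlib.GroupTheory.FreeAbelianGroup
import Mathlib.RingTheory.Coprime.Lemmas
import Mathlib.RingTheory.Int.Basic
import Mathlib.Algebra.BigOperators.Intervals
import Mathlib.Algebra.BigOperators.Fin
import Mathlib.FieldTheory.Finite.Basic
import Mathlib.Algebra.CharP.Two
import Mathlib.Tactic

/-!
# A parity distribution on `ℚ` killing the standard Beta-symbol relators at every level

Tool file for `GapSectorBeyondTwelve` (stmt-KontsevichZagierPeriods-14858, route
`TerasomaMultiplication`).  The item restricts crux 5 `GammaHodgeSector` to Beta data whose symbol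
difference lies OUTSIDE `RelSpan ⊔ ℤ·g₁₂`, `RelSpan` being the subgroup of the free abelian group
`ℤ[ℚ × ℚ]` generated by the six standard relator families (symmetry, translation, Dirichlet
re-association, Gauss multiplication for every `n ≥ 2`, Euler reflection, unit) and
`g₁₂ = [1/12,1/4] − [1/4,1/4]`.  To certify that this residual sector is inhabited one needs an
additive functional on `ℤ[ℚ × ℚ]` vanishing on ALL these generators — at every level at once, not
only on a finite lattice — and non-zero on a Hodge-type symbol.  This file constructs one:

* `chi q ∈ ℤ/2` is `1` iff the reduced denominator of `q` is odd and divisible by `5`;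
* `chi` is `1`-periodic and even, vanishes on integers, and is a PARITY DISTRIBUTION:
  `∑_{k<n} chi ((x+k)/n) = chi x` for every `n ≥ 1` (`sum_chi_div`; primes by a residue count,
  general `n` by composing fibres);
* `Phi [a,b] = chi a + chi b + chi (a+b)` extends additively to `FreeAbelianGroup (ℚ × ℚ)`
  (`Phi_of`); that it kills every standard relator pair and `g₁₂` while
  `Phi ([4/15,1/5] − [1/3,2/15]) = 1`, so that Das's level-15 pair is outside `RelSpan ⊔ ℤ·g₁₂`,
  is the companion file `…GapSectorBeyondTwelveSymbol` (theorems only; this file holds the three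
  definitions `chi`, `wt`, `Phi` and the distribution law).

Mathematically `chi` is the `𝔽₂`-valued even ordinary distribution `y ↦ [y₂ = 0]·[y₅ ≠ 0]` on
`ℚ/ℤ = ⊕ₚ ℚₚ/ℤₚ`; such torsion-valued distributions are exactly what detects the Yamamoto–Das
2-torsion of the universal odd distribution (Das 2000; Anderson 2002), invisible to all
`ℚ`-valued (Bernoulli) distributions, i.e. to the Hodge-type test. [folklore]
-/

namespace Summit.KontsevichZagierPeriods.TerasomaMultiplication.GapSectorBeyondTwelveParity

open Finset

/-! ### The weight `chi` -/

/-- The parity weight `χ(q) ∈ ℤ/2`: `1` iff the (reduced) denominator of `q` is odd and divisible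
by `5`, i.e. `v₂(q) ≥ 0` and `v₅(q) < 0`. [folklore] -/
def chi (q : ℚ) : ZMod 2 := if ¬ 2 ∣ q.den ∧ 5 ∣ q.den then 1 else 0

/-- Unfolding lemma for `chi`. [folklore] -/
theorem chi_eq (q : ℚ) : chi q = if ¬ 2 ∣ q.den ∧ 5 ∣ q.den then 1 else 0 := rfl

/-- `chi` only depends on the denominator. [folklore] -/
theorem chi_congr {q r : ℚ} (h : q.den = r.den) : chi q = chi r := by
  simp [chi_eq, h]

/-- `chi` is `1`-periodic (integer translates). [folklore] -/
@[simp] theorem chi_add_intCast (q : ℚ) (n : ℤ) : chi (q + n) = chi q :=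
  chi_congr (Rat.add_intCast_den q n)

/-- `chi` is `1`-periodic (natural translates). [folklore] -/
@[simp] theorem chi_add_natCast (q : ℚ) (n : ℕ) : chi (q + n) = chi q :=
  chi_congr (Rat.add_natCast_den q n)

/-- `chi` is `1`-periodic. [folklore] -/
@[simp] theorem chi_add_one (q : ℚ) : chi (q + 1) = chi q := by
  simpa using chi_add_natCast q 1

/-- `chi` is even. [folklore] -/
@[simp] theorem chi_neg (q : ℚ) : chi (-q) = chi q :=
  chi_congr (Rat.den_neg_eq_den q)

/-- `chi (1 - q) = chi q`. [folklore] -/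
@[simp] theorem chi_one_sub (q : ℚ) : chi (1 - q) = chi q := by
  rw [sub_eq_neg_add, chi_add_one, chi_neg]

/-- `chi` vanishes on integers. [folklore] -/
@[simp] theorem chi_intCast (n : ℤ) : chi n = 0 := by
  simp [chi_eq]

/-- `chi` vanishes on naturals. [folklore] -/
@[simp] theorem chi_natCast (n : ℕ) : chi n = 0 := by
  simp [chi_eq]

/-- `chi 0 = 0`. [folklore] -/
@[simp] theorem chi_zero : chi 0 = 0 := by
  simp [chi_eq]

/-- `chi 1 = 0`. [folklore] -/
@[simp] theorem chi_one : chi 1 = 0 := by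
  simp [chi_eq]

/-! ### Denominators -/

/-- Denominator of a reduced fraction `a / b` (`a : ℤ`, `b : ℕ`). [folklore] -/
theorem den_div_natCast {a : ℤ} {b : ℕ} (hb : 0 < b) (h : Nat.Coprime a.natAbs b) :
    ((a : ℚ) / (b : ℚ)).den = b := by
  have h1 := Rat.den_div_eq_of_coprime (a := a) (b := (b : ℤ)) (by exact_mod_cast hb)
    (by simpa using h)
  have h2 : ((((a : ℚ) / (b : ℚ)).den : ℤ)) = b := by simpa [Int.cast_natCast] using h1
  exact_mod_cast h2

/-- Denominator of a reduced fraction `a / b` of naturals. [folklore] -/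
theorem den_natCast_div {a b : ℕ} (hb : 0 < b) (h : Nat.Coprime a b) :
    ((a : ℚ) / (b : ℚ)).den = b :=
  den_div_natCast (a := (a : ℤ)) hb (by simpa using h)

/-- Coprimality of `q.num + k·q.den` with `q.den`. [folklore] -/
theorem coprime_num_add_mul_den (q : ℚ) (k : ℤ) :
    Nat.Coprime (q.num + k * q.den).natAbs q.den := by
  have h0 : IsCoprime q.num (q.den : ℤ) := by
    rw [Int.isCoprime_iff_gcd_eq_one, Int.gcd_eq_natAbs]
    simpa using Nat.Coprime.gcd_eq_one q.reduced
  have h1 : IsCoprime (q.num + k * q.den) (q.den : ℤ) := h0.add_mul_right_left k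
  rw [Int.isCoprime_iff_gcd_eq_one, Int.gcd_eq_natAbs] at h1
  exact Nat.coprime_iff_gcd_eq_one.mpr (by simpa using h1)

/-- `x + k = (x.num + k·x.den) / x.den`. [folklore] -/
theorem add_natCast_eq_div (x : ℚ) (k : ℕ) :
    x + k = ((x.num + k * x.den : ℤ) : ℚ) / (x.den : ℚ) := by
  have hd0 : (x.den : ℚ) ≠ 0 := by exact_mod_cast x.den_pos.ne'
  rw [eq_div_iff hd0]
  push_cast
  rw [add_mul, Rat.mul_den_eq_num]

/-- Denominator of `(x + k)/p` for a prime `p`: it is `x.den` if `p ∣ x.num + k·x.den`, and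
`p · x.den` otherwise. [folklore] -/
theorem den_add_div_prime (x : ℚ) (k : ℕ) {p : ℕ} (hp : p.Prime) :
    ((x + k) / p).den = if (p : ℤ) ∣ x.num + k * x.den then x.den else p * x.den := by
  have hp0 : (p : ℚ) ≠ 0 := by exact_mod_cast hp.ne_zero
  have hxk := add_natCast_eq_div x k
  have hcop := coprime_num_add_mul_den x k
  split_ifs with h
  · obtain ⟨m, hm⟩ := h
    have hcopm : Nat.Coprime m.natAbs x.den := by
      refine Nat.Coprime.coprime_dvd_left ?_ hcop
      exact ⟨p, by rw [hm, Int.natAbs_mul, Int.natAbs_natCast, mul_comm]⟩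
    have hval : (x + k) / p = (m : ℚ) / (x.den : ℚ) := by
      rw [hxk, hm, div_div, mul_comm (x.den : ℚ) (p : ℚ)]
      push_cast
      rw [mul_div_mul_left _ _ hp0]
    rw [hval]
    exact den_div_natCast x.den_pos hcopm
  · have hcopp : Nat.Coprime (x.num + k * x.den).natAbs p :=
      Nat.Coprime.symm ((Nat.Prime.coprime_iff_not_dvd hp).mpr fun hd =>
        h (Int.ofNat_dvd_left.mpr hd))
    have hcop' : Nat.Coprime (x.num + k * x.den).natAbs (p * x.den) :=
      Nat.Coprime.mul_right hcopp hcop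
    have hval : (x + k) / p = ((x.num + k * x.den : ℤ) : ℚ) / ((p * x.den : ℕ) : ℚ) := by
      rw [hxk, div_div]
      push_cast
      ring
    rw [hval]
    exact den_div_natCast (Nat.mul_pos hp.pos x.den_pos) hcop'

/-! ### The parity distribution law -/

/-- For a prime `p` not dividing `b` and `a` arbitrary, exactly one `k < p` has `p ∣ a + k b`.
[folklore] -/
theorem card_filter_dvd_eq_one {p : ℕ} (hp : p.Prime) (a : ℤ) (b : ℕ) (hb : ¬ p ∣ b) :
    ((range p).filter fun k : ℕ => (p : ℤ) ∣ a + k * b).card = 1 := by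
  haveI := Fact.mk hp
  have hbu : (b : ZMod p) ≠ 0 := by
    rwa [Ne, ZMod.natCast_eq_zero_iff]
  set k₀ : ℕ := ((-(a : ZMod p)) * (b : ZMod p)⁻¹).val with hk₀
  have key : ∀ k : ℕ, ((p : ℤ) ∣ a + k * b) ↔ ((k : ZMod p) = -(a : ZMod p) * (b : ZMod p)⁻¹) := by
    intro k
    rw [← ZMod.intCast_zmod_eq_zero_iff_dvd]
    push_cast
    constructor
    · intro h
      have h' : (k : ZMod p) * b = -a := by linear_combination h
      rw [← h', mul_inv_cancel_right₀ hbu]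
    · intro h
      rw [h, inv_mul_cancel_right₀ hbu, add_neg_cancel]
  have hk₀' : ((k₀ : ℕ) : ZMod p) = -(a : ZMod p) * (b : ZMod p)⁻¹ := by
    rw [hk₀, ZMod.natCast_zmod_val]
  refine card_eq_one.mpr ⟨k₀, ?_⟩
  ext k
  simp only [mem_filter, mem_range, mem_singleton]
  constructor
  · rintro ⟨hk, hdvd⟩
    have h1 : (k : ZMod p) = (k₀ : ZMod p) := by rw [(key k).mp hdvd, hk₀']
    rw [ZMod.natCast_eq_natCast_iff'] at h1
    rwa [Nat.mod_eq_of_lt hk, Nat.mod_eq_of_lt (ZMod.val_lt _)] at h1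
  · rintro rfl
    exact ⟨ZMod.val_lt _, (key k₀).mpr hk₀'⟩

/-- The parity distribution law at a PRIME: `∑_{k<p} χ((x+k)/p) = χ(x)`. [folklore] -/
theorem sum_chi_div_prime (x : ℚ) {p : ℕ} (hp : p.Prime) :
    ∑ k ∈ range p, chi ((x + k) / p) = chi x := by
  have hterm : ∀ k : ℕ, chi ((x + k) / p) =
      if (p : ℤ) ∣ x.num + k * x.den then chi x
      else (if ¬ 2 ∣ p * x.den ∧ 5 ∣ p * x.den then 1 else 0) := by
    intro k
    rw [chi_eq ((x + k) / p), den_add_div_prime x k hp]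
    by_cases h : (p : ℤ) ∣ x.num + k * x.den
    · rw [if_pos h, if_pos h, chi_eq]
    · rw [if_neg h, if_neg h]
  simp_rw [hterm]
  rw [sum_ite, sum_const, sum_const]
  generalize hG : (if ¬ 2 ∣ p * x.den ∧ 5 ∣ p * x.den then (1 : ZMod 2) else 0) = G
  have hcard := card_filter_add_card_filter_not
    (s := range p) (fun k : ℕ => (p : ℤ) ∣ x.num + k * x.den)
  rw [card_range] at hcard
  by_cases hb : p ∣ x.den
  · -- no `k` qualifies: `p ∣ x.num + k x.den` would force `p ∣ x.num`
    have hnone : ((range p).filter fun k : ℕ => (p : ℤ) ∣ x.num + k * x.den) = ∅ := by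
      refine filter_false_of_mem fun k _ hk => ?_
      have hkb : (p : ℤ) ∣ (k : ℤ) * x.den := Dvd.dvd.mul_left (Int.natCast_dvd_natCast.mpr hb) _
      have hpa : (p : ℤ) ∣ x.num := (dvd_add_left hkb).mp hk
      have hpa' : p ∣ x.num.natAbs := Int.ofNat_dvd_left.mp hpa
      have hg : p ∣ Nat.gcd x.num.natAbs x.den := Nat.dvd_gcd hpa' hb
      rw [Nat.Coprime.gcd_eq_one x.reduced] at hg
      exact hp.one_lt.ne' (Nat.dvd_one.mp hg)
    rw [hnone] at hcard ⊢
    simp only [card_empty, zero_add] at hcard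
    rw [hcard, card_empty, zero_smul, zero_add]
    rcases hp.eq_two_or_odd' with rfl | hodd
    · -- `p = 2 ∣ x.den`: both sides vanish
      have h2 : (2 : ℕ) ∣ x.den := hb
      have hG0 : G = 0 := by rw [← hG, if_neg (by simp)]
      rw [hG0, smul_zero, chi_eq, if_neg (by simp [h2])]
    · have hp2 : ¬ 2 ∣ p := Nat.two_dvd_ne_zero.mpr (Nat.odd_iff.mp hodd)
      have hsmul : p • G = G := by
        rw [nsmul_eq_mul, ZMod.natCast_eq_one_iff_odd.mpr hodd, one_mul]
      have e2 : (2 ∣ p * x.den) ↔ 2 ∣ x.den := by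
        constructor
        · intro h
          rcases (Nat.Prime.dvd_mul Nat.prime_two).mp h with h | h
          · exact absurd h hp2
          · exact h
        · exact fun h => Dvd.dvd.mul_left h p
      have e5 : (5 ∣ p * x.den) ↔ 5 ∣ x.den := by
        constructor
        · intro h
          rcases (Nat.Prime.dvd_mul (by norm_num : Nat.Prime 5)).mp h with h | h
          · have h5 : p = 5 := ((Nat.prime_dvd_prime_iff_eq (by norm_num) hp).mp h).symm
            subst h5
            exact hb
          · exact h
        · exact fun h => Dvd.dvd.mul_left h p
      rw [hsmul, ← hG, chi_eq]
      simp only [e2, e5]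
  · rw [card_filter_dvd_eq_one hp x.num x.den hb] at hcard ⊢
    rw [one_smul]
    have hrest : ((range p).filter fun k : ℕ => ¬ (p : ℤ) ∣ x.num + k * x.den).card = p - 1 := by
      omega
    rw [hrest]
    rcases hp.eq_two_or_odd' with rfl | hodd
    · have hG0 : G = 0 := by rw [← hG, if_neg (by simp)]
      rw [hG0, smul_zero, add_zero]
    · have hne : p ≠ 2 := by
        rintro rfl
        exact (Nat.not_even_iff_odd.mpr hodd) even_two
      rw [nsmul_eq_mul, ZMod.natCast_eq_zero_iff_even.mpr (hp.even_sub_one hne), zero_mul,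
        add_zero]

/-- Splitting a sum over `range (p * m)` along `k = j + m i`. [folklore] -/
theorem sum_range_mul_split {M : Type*} [AddCommMonoid M] (g : ℕ → M) (p m : ℕ) :
    ∑ k ∈ range (p * m), g k = ∑ i ∈ range p, ∑ j ∈ range m, g (j + m * i) := by
  induction p with
  | zero => simp
  | succ p ih =>
    rw [Nat.succ_mul, sum_range_add, ih, sum_range_succ]
    congr 1
    refine sum_congr rfl fun j _ => ?_
    rw [add_comm (p * m) j, mul_comm p m]

/-- **The parity distribution law**: `∑_{k<n} χ((x+k)/n) = χ(x)` for every `n ≥ 1` and every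
rational `x` (primes: `sum_chi_div_prime`; composites: the fibres of `y ↦ n y` compose).
[folklore] -/
theorem sum_chi_div (n : ℕ) (hn : 0 < n) (x : ℚ) :
    ∑ k ∈ range n, chi ((x + k) / n) = chi x := by
  induction n using Nat.strong_induction_on generalizing x with
  | _ n ih =>
    rcases Nat.lt_or_ge 1 n with h1 | h1
    · -- `n ≥ 2`: peel off the least prime factor
      have hpr : (n.minFac).Prime := Nat.minFac_prime h1.ne'
      obtain ⟨m, hm⟩ : n.minFac ∣ n := Nat.minFac_dvd n
      have hm0 : 0 < m := by
        rcases Nat.eq_zero_or_pos m with h0 | h0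
        · rw [h0, mul_zero] at hm
          omega
        · exact h0
      have hmn : m < n := by
        have h2 : m < n.minFac * m := lt_mul_left hm0 hpr.one_lt
        rwa [← hm] at h2
      have hmq : (m : ℚ) ≠ 0 := by exact_mod_cast hm0.ne'
      have hgoal : ∑ k ∈ range (n.minFac * m), chi ((x + k) / ((n.minFac * m : ℕ) : ℚ)) = chi x := by
        rw [sum_range_mul_split _ n.minFac m]
        calc ∑ i ∈ range n.minFac, ∑ j ∈ range m,
              chi ((x + ((j + m * i : ℕ) : ℚ)) / ((n.minFac * m : ℕ) : ℚ))
            = ∑ j ∈ range m, ∑ i ∈ range n.minFac, chi (((x + j) / m + i) / n.minFac) := by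
              rw [sum_comm]
              refine sum_congr rfl fun j _ => sum_congr rfl fun i _ => ?_
              congr 1
              rw [div_add' _ _ _ hmq, div_div]
              push_cast
              congr 1 <;> ring
          _ = ∑ j ∈ range m, chi ((x + j) / m) :=
              sum_congr rfl fun j _ => sum_chi_div_prime _ hpr
          _ = chi x := ih m hmn hm0 x
      rw [hm]
      exact hgoal
    · -- `n = 1`
      obtain rfl : n = 1 := le_antisymm h1 hn
      simp

/-- Corollary: `∑_{k<n} χ(k/n) = 0`. [folklore] -/
theorem sum_chi_div_zero (n : ℕ) (hn : 0 < n) : ∑ k ∈ range n, chi ((k : ℚ) / n) = 0 := by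
  have h := sum_chi_div n hn 0
  simpa using h

/-- Corollary: `∑_{k<n} χ(s + k/n) = χ(n s)`. [folklore] -/
theorem sum_chi_add_div (n : ℕ) (hn : 0 < n) (s : ℚ) :
    ∑ k ∈ range n, chi (s + (k : ℚ) / n) = chi (n * s) := by
  have h := sum_chi_div n hn (n * s)
  have hnq : (n : ℚ) ≠ 0 := by exact_mod_cast hn.ne'
  rw [← h]
  refine sum_congr rfl fun k _ => ?_
  rw [add_div, mul_div_cancel_left₀ s hnq]

/-! ### The functional `Phi` on Beta symbols -/

/-- The symbol weight `[a,b] ↦ χ(a) + χ(b) + χ(a+b)`. [folklore] -/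
def wt (q : ℚ × ℚ) : ZMod 2 := chi q.1 + chi q.2 + chi (q.1 + q.2)

/-- The additive functional `Φ : ℤ[ℚ × ℚ] → ℤ/2` extending `wt`. [folklore] -/
def Phi : FreeAbelianGroup (ℚ × ℚ) →+ ZMod 2 := FreeAbelianGroup.lift wt

/-- `Φ` on a generator. [folklore] -/
@[simp] theorem Phi_of (a b : ℚ) :
    Phi (FreeAbelianGroup.of (a, b)) = chi a + chi b + chi (a + b) := by
  simp [Phi, wt, FreeAbelianGroup.lift_apply_of]

end Summit.KontsevichZagierPeriods.TerasomaMultiplication.GapSectorBeyondTwelveParity
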